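import Summits.AtomisticToContinuum.BoseEinsteinCondensation.Theorems.BECCutLineWeakDisorderLandscapeBoundSiblingCompose
import HarnessLib

/-!
# Crux `TwoReplicaTransienceBound` (stmt-AtomisticToContinuum-9687) — CHECKED SKELETON of the line
# `kinetic-block-bolthausen` (the kinetic-scale block frame; crux-plan of idea
# `Ideas/kinetic-block-bolthausen.md`, sharpened by TRIAGE-r2-1/2/3)

**The crux** (`Theses/BECCutLineWeakDisorder.lean`, `def TwoReplicaTransienceBound`): for every
admissible `v`, `ρ < ρ₀(v)`, some `C`, eventually in `n`, for all `T ≥ 1`: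
`∫ L³ m_T(Y)²/s_T(Y)² dY ≤ C` for the cut-line witnesses `Ψ_T = fkWitness v L T 1`,
`L = sideLength ρ (n+1)` (`m_T(Y) = ∫|Ψ_T(x,Y)|²dx`, `s_T(Y) = ∫|Ψ_T(x,Y)|dx`).

**The line (block factorisation at the kinetic length).** Slice by slice the participation ratio
factorises EXACTLY over the dyadic blocks of depth `K` (side `ℓ_K = L2^{-K}`):
`L³ m/s² = r̄_K · C_K`, with the WITHIN-block factor `r̄_K = ℓ_K³ m / Σ_Q a_Q²`
(`uvParticipation`) and the ACROSS-block factor `C_K = 8^K Σ_Q a_Q² / s² = ∏_{j<K}(1 + X_j)`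
(`coarsePR`, the participation ratio of the coarse-grained endpoint law; `X_j = siblingExcess`),
cf. the tree's `landscape_le_telescope`. Choose `K` at the KINETIC length `√(κ/ρ)`
(`kineticDepth κ ρ L`), the one `v`-dependent, `N`-independent scale below which the landed
kinetic-window technology lives, and split the slice-law average by Cauchy–Schwarz:
`E_m[R] ≤ (E_m r̄_K²)^{1/2} (E_m C_K²)^{1/2}`. The two factors are the two registered stubs:

* `stub_kineticScaleFlatness : KineticScaleFlatness` — UV: `E_m[r̄_K²] ≤ C` at `K = kineticDepth κ ρ L`
  for SOME `κ > 0` (verbatim the typed target of card `tagged-shift-log-harnack`,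
  `IdeatorSketch5.KineticScaleFlatness`; one statement, two lines);
* `stub_coarseSecondMoment : CoarseSecondMoment` — IR (rank 2, load-bearing): `E_m[C_K²] ≤ C` at
  `K = kineticDepth κ ρ L` for SOME `κ > 0` — the coarse two-replica functional at block resolution
  `≍ √(κ/ρ)`, the docking target of the two surviving IR devices (cards
  `slice-tensorisation-second-moment`, `across-cut-thinning`), BEC-strength as declared.

The two stubs may choose DIFFERENT kinetic constants `κ_UV`, `κ_IR`: the composition telescopes at
the finer of the two depths, moves the UV factor to the UV depth by the antitonicity of `r̄_K` in
the depth (`uvParticipation_anti`, children Cauchy–Schwarz), and pays for the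
`(K_UV - K_IR)⁺ ≤ log₂⌊√(κ_IR/ρ)⌋` octaves in between with the FREE range bound `1 + X_j ≤ 8`
(`siblingExcess_le_seven`) — a constant `64^{log₂⌊√(κ_IR/ρ)⌋}` fixed once `ρ` is (scale
handshake `coarsePR_le_pow_mul`, `kineticDepth_le_add`). Composition
`TwoReplicaTransienceBound_of : Goal.stub_kineticScaleFlatness → Goal.stub_coarseSecondMoment → TwoReplicaTransienceBound`
(aliases `Goal.stub_* := ` the two statements) is sorry-free; sorries ONLY in the two `stub_*`.

Honoured Disproof (`Cruxes/TwoReplicaTransienceBound/Disproof.lean`, cdisprove c1): §1 (junk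
regimes make the crux true — both stubs evaluate to `0 ≤ C` on a degenerate witness); §2
`not_twoReplicaTransienceBoundBelowOne` / `Negative/ConstantAtLeastOne` (C ≥ 1: `r̄_K ≥ 1`,
`C_K ≥ 1` off junk); §Line (annealed SAME-SIDE tracer moments die per box, `e^{γₙT}`): nothing
here is annealed — both stubs are slice-law moments of functionals of the quenched profile
`|Ψ_T(·,Y)|`. No `_false_without_` theorem exists for this crux.
-/

noncomputable section

open MeasureTheory Filter Set Finset
open scoped ENNReal NNReal Topology BigOperators

namespace Summit.AtomisticToContinuum.BoseEinsteinCondensation.Cruxes.TwoReplicaTransienceBound.KineticBlockBolthausen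

open Literature.MathematicalPhysics.QuantumManyBody.BoseGas
open Summit.AtomisticToContinuum.BoseEinsteinCondensation.Theses.BECCutLineWeakDisorder
open Summit.AtomisticToContinuum.BoseEinsteinCondensation.Cruxes.LandscapeBound.SiblingTelescopingChaining

variable {n : ℕ}

/-! ### Objects -/

/-- The dyadic level whose blocks have side `≈ √(κ/ρ)` (the KINETIC length): `depth L - ⌊log₂ ⌊√(κ/ρ)⌋⌋`,
blocks of side `L·2^{-K} ∈ (√(κ/ρ)/4, √(κ/ρ)]` once `L` is large (natural subtraction: never finer
than the unit scale `depth L`). VERBATIM `IdeatorSketch5.kineticDepth` (card `tagged-shift-log-harnack`),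
so that `KineticScaleFlatness` below is literally that card's typed target. -/
def kineticDepth (κ ρ L : ℝ) : ℕ := depth L - Nat.log 2 ⌊Real.sqrt (κ / ρ)⌋₊

/-- **The across-block (coarse, infrared) participation at depth `K`**:
`C_K(g) = ∏_{j<K} (1 + X_j(g)) = 8^K S_K(g)/S_0(g)` (`prod_ratio_eq`; `= M³ Σ_Q a_Q²/(Σ_Q a_Q)²`,
`M = 2^K`, for `g` vanishing off the box) — the participation ratio of the COARSE-GRAINED endpoint law
`(a_Q/s)_Q` on the block lattice; junk value `0` when some `S_j ∈ {0, ∞}`. -/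
def coarsePR (g : Space → ℝ≥0∞) (L : ℝ) (K : ℕ) : ℝ :=
  ∏ j ∈ Finset.range K, (1 + siblingExcess g L j)

/-! ### The two statements of the line -/

/-- STUB `stub_kineticScaleFlatness` — **UV: within-block flatness of the cut-line witness at the
kinetic scale, second moment under the slice law, uniformly in `n` and `T ≥ 1`, for every admissible
`v`** (VERBATIM `IdeatorSketch5.KineticScaleFlatness`, the typed target of card
`tagged-shift-log-harnack`; = the sibling line's `UVFlatness` with the depth lowered from the unit
scale to `kineticDepth κ ρ L`): for SOME `κ > 0`, small `ρ`, some `C`, eventually in `n`, all `T ≥ 1`,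
`E_m[r̄_K²] = ∫ m(Y) r̄_K(g_Y)² dY ≤ C`, `g_Y = |Ψ_T(·,Y)|`, `K = kineticDepth κ ρ L`.
Free gas: `r̄_K → 1 + O(wall layer)`, bounded by `(4/3)⁶`-type constants. One FIXED `N`-independent
scale; classical strength (tilted-law crowding + tagged displacement over a window `≤ κ/ρ`). -/
def KineticScaleFlatness : Prop :=
  ∀ v : ℝ → ℝ≥0∞, IsRepulsiveFiniteRange v → ∃ κ : ℝ, 0 < κ ∧ ∃ ρ₀ : ℝ, 0 < ρ₀ ∧
    ∀ ρ : ℝ, 0 < ρ → ρ < ρ₀ → ∃ C : ℝ, 0 < C ∧ ∀ᶠ n : ℕ in atTop, ∀ T : ℝ, 1 ≤ T →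
      ∫⁻ Y : Config n,
          (∫⁻ x, slice (fkWitness (N := n + 1) v (sideLength ρ (n + 1)) T (fun _ => (1 : ℝ≥0∞))) Y x ^ 2) *
            uvParticipation
              (slice (fkWitness (N := n + 1) v (sideLength ρ (n + 1)) T (fun _ => (1 : ℝ≥0∞))) Y)
              (sideLength ρ (n + 1))
              (kineticDepth κ ρ (sideLength ρ (n + 1))) ^ 2 ≤
        ENNReal.ofReal C

/-- STUB `stub_coarseSecondMoment` (rank 2, the load-bearing stub) — **IR: the across-block
participation of the coarse-grained endpoint law at the kinetic scale has a bounded second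
slice-law moment, uniformly in `n` and `T ≥ 1`**: for SOME `κ > 0`, small `ρ`, some `C`,
eventually in `n`, all `T ≥ 1`, `E_m[C_K²] = ∫ m(Y) C_K(g_Y)² dY ≤ C`, `K = kineticDepth κ ρ L`.
Free gas: `C_K → L³∫θ_T²/(∫θ_T)² ≤ (π²/8)³` deterministically (the Dirichlet profile number lives
HERE, not in the UV factor). Content: the two-replica overlap of the tagged half-line's endpoint law
read on blocks of side `≍ √(κ/ρ)` — by the card's diagnosis (iv) = (fixed-scale self-averaging of
the block masses under the slice law) × (block-level `N/n₀` of the witness `Ψ_T`): BEC-strength,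
declared; the docking target of the IR devices of cards `slice-tensorisation-second-moment`
(variance tensorisation of the bath slice law + one-particle influence, closure PROVED at second
order) and `across-cut-thinning` (FTC reduction + tilt-uniform two-point domination), whose shared
bath-only hypothesis is the depth-uniform Dirichlet susceptibility INTEGRABILITY
`m₋₁(k) ≤ C′(ρa)^{-(1+ε)/2} k^{-1+ε}` (`2π/L ≤ k ≤ √(ρa)`) — the card's (H-IR), a full power of `k`
weaker than bounded compressibility (second-order across-block coupling `∝ ρa²∫m₋₁dk`). -/
def CoarseSecondMoment : Prop :=
  ∀ v : ℝ → ℝ≥0∞, IsRepulsiveFiniteRange v → ∃ κ : ℝ, 0 < κ ∧ ∃ ρ₀ : ℝ, 0 < ρ₀ ∧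
    ∀ ρ : ℝ, 0 < ρ → ρ < ρ₀ → ∃ C : ℝ, 0 < C ∧ ∀ᶠ n : ℕ in atTop, ∀ T : ℝ, 1 ≤ T →
      ∫⁻ Y : Config n,
          (∫⁻ x, slice (fkWitness (N := n + 1) v (sideLength ρ (n + 1)) T (fun _ => (1 : ℝ≥0∞))) Y x ^ 2) *
            ENNReal.ofReal (coarsePR
              (slice (fkWitness (N := n + 1) v (sideLength ρ (n + 1)) T (fun _ => (1 : ℝ≥0∞))) Y)
              (sideLength ρ (n + 1))
              (kineticDepth κ ρ (sideLength ρ (n + 1)))) ^ 2 ≤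
        ENNReal.ofReal C

/-! ### Audit aliases (= the registered stub signatures) -/

namespace Goal

/-- Registered stub `stub_kineticScaleFlatness` (UV; shared with line `tagged-shift-log-harnack`). -/
abbrev stub_kineticScaleFlatness : Prop := KineticScaleFlatness

/-- Registered stub `stub_coarseSecondMoment` (IR; rank 2, load-bearing). -/
abbrev stub_coarseSecondMoment : Prop := CoarseSecondMoment

end Goal

/-! ### Registered stubs (sorries ONLY here) -/

/-- STUB (OPEN; UV module, shared with line `tagged-shift-log-harnack`): within-block flatness at the
kinetic scale. -/
theorem stub_kineticScaleFlatness : Goal.stub_kineticScaleFlatness := by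
  sorry

/-- STUB (OPEN; rank 2, load-bearing, BEC-strength): coarse two-replica second moment at the kinetic
scale. -/
theorem stub_coarseSecondMoment : Goal.stub_coarseSecondMoment := by
  sorry

/-! ### Glue I: the within-block participation is antitone in the depth (children Cauchy–Schwarz) -/

/-- Cauchy–Schwarz for a finite `ℝ≥0∞`-sum: `(Σ_e a_e)² ≤ #s · Σ_e a_e²`. [folklore] -/
theorem sq_sum_le_card_mul_sum_sq_ennreal {ι : Type*} (s : Finset ι) (a : ι → ℝ≥0∞) :
    (∑ e ∈ s, a e) ^ 2 ≤ (s.card : ℝ≥0∞) * ∑ e ∈ s, a e ^ 2 := by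
  have h := ENNReal.rpow_sum_le_const_mul_sum_rpow s a (p := 2) (by norm_num)
  norm_num at h
  simpa [ENNReal.rpow_two] using h

/-- **Children Cauchy–Schwarz: `S_j ≤ 8 S_{j+1}`** (`a_Q² = (Σ_{c⊂Q} a_c)² ≤ 8 Σ_c a_c²`). [folklore] -/
theorem levelSq_le_eight_mul_succ (g : Space → ℝ≥0∞) (L : ℝ) (j : ℕ) :
    levelSq g L j ≤ 8 * levelSq g L (j + 1) := by
  rcases le_or_gt L 0 with hL | hL
  · simp [levelSq_eq_zero_of_nonpos hL]
  rw [levelSq_succ_eq, Finset.mul_sum]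
  unfold levelSq
  gcongr with i
  rw [blockMass_eq_sum_children hL]
  refine (sq_sum_le_card_mul_sum_sq_ennreal _ _).trans ?_
  simp [Fintype.card_fin, Fintype.card_pi]

/-- `S_{K'} ≤ 8^{K-K'} S_K` for `K' ≤ K`. [folklore] -/
theorem levelSq_le_pow_mul (g : Space → ℝ≥0∞) (L : ℝ) {K' K : ℕ} (h : K' ≤ K) :
    levelSq g L K' ≤ 8 ^ (K - K') * levelSq g L K := by
  obtain ⟨d, rfl⟩ := Nat.exists_eq_add_of_le h
  rw [Nat.add_sub_cancel_left]
  induction d with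
  | zero => simp
  | succ d ih =>
    calc levelSq g L K' ≤ 8 ^ d * levelSq g L (K' + d) := ih (Nat.le_add_right _ _)
      _ ≤ 8 ^ d * (8 * levelSq g L (K' + d + 1)) := by
          gcongr; exact levelSq_le_eight_mul_succ g L _
      _ = 8 ^ (d + 1) * levelSq g L (K' + (d + 1)) := by rw [pow_succ]; ring_nf

/-- **`r̄_K` is antitone in the depth**: `r̄_K ≤ r̄_{K'}` for `K' ≤ K` (coarser blocks are at least as
un-flat as finer ones; `S_{K'} ≤ 8^{K-K'} S_K` and `ℓ_{K'}³ = 8^{K-K'} ℓ_K³`). [folklore] -/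
theorem uvParticipation_anti (g : Space → ℝ≥0∞) {L : ℝ} (hL : 0 ≤ L) {K' K : ℕ} (h : K' ≤ K) :
    uvParticipation g L K ≤ uvParticipation g L K' := by
  unfold uvParticipation
  set m := ∫⁻ x, g x ^ 2
  have hS := levelSq_le_pow_mul g L h
  have hℓ : ENNReal.ofReal ((L / 2 ^ K') ^ 3) =
      ENNReal.ofReal ((L / 2 ^ K) ^ 3) * 8 ^ (K - K') := by
    obtain ⟨d, rfl⟩ := Nat.exists_eq_add_of_le h
    rw [Nat.add_sub_cancel_left, show (8 : ℝ≥0∞) ^ d = ENNReal.ofReal ((8 : ℝ) ^ d) by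
      rw [ENNReal.ofReal_pow (by norm_num)]; norm_num, ← ENNReal.ofReal_mul (by positivity)]
    congr 1
    rw [pow_add, div_pow, div_pow, mul_pow, show ((2 : ℝ) ^ d) ^ 3 = 8 ^ d by
      rw [← pow_mul, mul_comm, pow_mul]; norm_num]
    field_simp
  rw [hℓ]
  have h8 : (8 : ℝ≥0∞) ^ (K - K') ≠ 0 := pow_ne_zero _ (by norm_num)
  have h8t : (8 : ℝ≥0∞) ^ (K - K') ≠ ⊤ := ENNReal.pow_ne_top (by norm_num)
  calc ENNReal.ofReal ((L / 2 ^ K) ^ 3) * m / levelSq g L K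
      = 8 ^ (K - K') * (ENNReal.ofReal ((L / 2 ^ K) ^ 3) * m) / (8 ^ (K - K') * levelSq g L K) :=
        (ENNReal.mul_div_mul_left _ _ h8 h8t).symm
    _ ≤ 8 ^ (K - K') * (ENNReal.ofReal ((L / 2 ^ K) ^ 3) * m) / levelSq g L K' :=
        ENNReal.div_le_div_left hS _
    _ = ENNReal.ofReal ((L / 2 ^ K) ^ 3) * 8 ^ (K - K') * m / levelSq g L K' := by ring_nf

/-! ### Glue II: the scale handshake (free octaves between the two kinetic depths) -/

/-- `0 ≤ 1 + X_j` (junk cases included). [folklore] -/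
theorem one_add_siblingExcess_nonneg (g : Space → ℝ≥0∞) (L : ℝ) (j : ℕ) :
    0 ≤ 1 + siblingExcess g L j := by
  unfold siblingExcess
  have : 0 ≤ (8 * levelSq g L (j + 1)).toReal / (levelSq g L j).toReal :=
    div_nonneg ENNReal.toReal_nonneg ENNReal.toReal_nonneg
  linarith

/-- `1 + X_j ≤ 8` (the FREE range bound, `siblingExcess_le_seven`). [folklore] -/
theorem one_add_siblingExcess_le_eight (g : Space → ℝ≥0∞) (L : ℝ) (j : ℕ) :
    1 + siblingExcess g L j ≤ 8 := by
  have := siblingExcess_le_seven g L j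
  linarith

/-- `0 ≤ C_K`. [folklore] -/
theorem coarsePR_nonneg (g : Space → ℝ≥0∞) (L : ℝ) (K : ℕ) : 0 ≤ coarsePR g L K :=
  Finset.prod_nonneg fun j _ => one_add_siblingExcess_nonneg g L j

/-- **Scale handshake**: refining the coarse participation by `K' - K` octaves costs at most `8` per
octave, `C_{K'} ≤ 8^{K'-K} C_K` for `K ≤ K'`. [folklore] -/
theorem coarsePR_le_pow_mul (g : Space → ℝ≥0∞) (L : ℝ) {K K' : ℕ} (h : K ≤ K') :
    coarsePR g L K' ≤ 8 ^ (K' - K) * coarsePR g L K := by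
  obtain ⟨d, rfl⟩ := Nat.exists_eq_add_of_le h
  rw [Nat.add_sub_cancel_left]
  unfold coarsePR
  rw [Finset.prod_range_add, mul_comm]
  refine mul_le_mul_of_nonneg_right ?_
    (Finset.prod_nonneg fun j _ => one_add_siblingExcess_nonneg g L j)
  calc ∏ x ∈ Finset.range d, (1 + siblingExcess g L (K + x))
      ≤ ∏ _x ∈ Finset.range d, (8 : ℝ) :=
        Finset.prod_le_prod (fun j _ => one_add_siblingExcess_nonneg g L _)
          (fun j _ => one_add_siblingExcess_le_eight g L _)
    _ = 8 ^ d := by rw [Finset.prod_const, Finset.card_range]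

/-- The two kinetic depths differ by at most the number of octaves below the coarser kinetic length:
`kineticDepth κ₁ ρ L ≤ kineticDepth κ₂ ρ L + log₂⌊√(κ₂/ρ)⌋` (natural-number bookkeeping). -/
theorem kineticDepth_le_add (κ₁ κ₂ ρ L : ℝ) :
    kineticDepth κ₁ ρ L ≤ kineticDepth κ₂ ρ L + Nat.log 2 ⌊Real.sqrt (κ₂ / ρ)⌋₊ := by
  unfold kineticDepth
  omega

/-! ### The composition (sorry-free): the crux BY NAME from the two registered stubs -/

/-- **`TwoReplicaTransienceBound` (stmt-AtomisticToContinuum-9687) BY NAME from the two registered stubs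
`Goal.stub_kineticScaleFlatness` (UV) and `Goal.stub_coarseSecondMoment` (IR)** — the kernel-checked
composition of the line (sorry-free): telescoping `R ≤ r̄_{K*} · C_{K*} · m` at `K* = max(K_UV, K_IR)`
(`landscape_le_telescope`), `r̄_{K*} ≤ r̄_{K_UV}` (`uvParticipation_anti`), `C_{K*} ≤ 8^{l} C_{K_IR}` with
`l = log₂⌊√(κ_IR/ρ)⌋` (`coarsePR_le_pow_mul`, `kineticDepth_le_add`), change of measure to the slice law
`m(Y)dY` (a probability law, `lintegral_lintegral_slice_sq`) and Cauchy–Schwarz; constants `ρ₀ = min`,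
`C = C_UV · 64^{l} · C_IR + 1`. -/
theorem TwoReplicaTransienceBound_of (hUV : Goal.stub_kineticScaleFlatness)
    (hIR : Goal.stub_coarseSecondMoment) :
    Summit.AtomisticToContinuum.BoseEinsteinCondensation.Theses.BECCutLineWeakDisorder.TwoReplicaTransienceBound := by
  intro v hv
  obtain ⟨κ₁, hκ₁, ρ₁, hρ₁, H1⟩ := hUV v hv
  obtain ⟨κ₂, hκ₂, ρ₂, hρ₂, H2⟩ := hIR v hv
  refine ⟨min ρ₁ ρ₂, lt_min hρ₁ hρ₂, fun ρ hρ hρlt => ?_⟩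
  obtain ⟨CU, hCU, ev1⟩ := H1 ρ hρ (hρlt.trans_le (min_le_left _ _))
  obtain ⟨CI, hCI, ev2⟩ := H2 ρ hρ (hρlt.trans_le (min_le_right _ _))
  set l₂ : ℕ := Nat.log 2 ⌊Real.sqrt (κ₂ / ρ)⌋₊ with hl₂def
  set E : ℝ := (64 : ℝ) ^ l₂ * CI with hEdef
  have hEpos : 0 < E := by positivity
  refine ⟨CU * E + 1, by positivity, ?_⟩
  filter_upwards [ev1, ev2] with n h1 h2 T hT
  have hvm : Measurable v := hv.1
  have hT0 : 0 ≤ T := zero_le_one.trans hT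
  set L : ℝ := sideLength ρ (n + 1) with hLdef
  have hLpos : 0 < L := Real.rpow_pos_of_pos (div_pos (Nat.cast_pos.mpr n.succ_pos) hρ) _
  set K₁ : ℕ := kineticDepth κ₁ ρ L with hK₁def
  set K₂ : ℕ := kineticDepth κ₂ ρ L with hK₂def
  set K : ℕ := max K₁ K₂ with hKdef
  have hK₁K : K₁ ≤ K := le_max_left _ _
  have hK₂K : K₂ ≤ K := le_max_right _ _
  have hKle : K ≤ K₂ + l₂ := max_le (kineticDepth_le_add κ₁ κ₂ ρ L) (Nat.le_add_right _ _)
  have hKK₂ : K - K₂ ≤ l₂ := by omega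
  set Ψ : Config (n + 1) → ℝ := fkWitness (N := n + 1) v L T (fun _ => (1 : ℝ≥0∞)) with hΨdef
  set 𝒩 : ℝ≥0∞ := fkNormSq (N := n + 1) v L T (fun _ => (1 : ℝ≥0∞)) with h𝒩def
  have hΨm : Measurable Ψ := measurable_fkWitness hvm L T measurable_const
  -- the goal, in the slice vocabulary
  change ∫⁻ Y : Config n, ENNReal.ofReal (L ^ 3) * (∫⁻ x, slice Ψ Y x ^ 2) ^ 2 /
      (∫⁻ x, slice Ψ Y x) ^ 2 ≤ ENNReal.ofReal (CU * E + 1)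
  -- degenerate normalisation: the witness vanishes
  by_cases hdeg : 𝒩 = 0 ∨ 𝒩 = ⊤
  · have hΨ0 : ∀ X, Ψ X = 0 := fkWitness_eq_zero_of_normSq hdeg
    have hsl : ∀ Y x, slice Ψ Y x = 0 := fun Y x => by
      simp [LandscapeBound.SiblingTelescopingChaining.slice, hΨ0]
    simp [hsl]
  simp only [not_or] at hdeg
  obtain ⟨h𝒩0, h𝒩t⟩ := hdeg
  -- the slice law
  set m : Config n → ℝ≥0∞ := fun Y => ∫⁻ x, slice Ψ Y x ^ 2 with hmdef
  have hm_meas : Measurable m := measurable_lintegral_slice_sq hΨm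
  have hm1 : ∫⁻ Y, m Y = 1 := lintegral_lintegral_slice_sq hvm L T h𝒩0 h𝒩t
  set μ : Measure (Config n) := volume.withDensity m with hμdef
  haveI : IsProbabilityMeasure μ :=
    ⟨by rw [hμdef, withDensity_apply _ MeasurableSet.univ, Measure.restrict_univ, hm1]⟩
  -- bound and support of the slices
  set Mr : ℝ := 1 / Real.sqrt 𝒩.toReal with hMrdef
  have hbound : ∀ Y x, slice Ψ Y x ≤ ENNReal.ofReal Mr := fun Y x => by
    show ((‖Ψ (Matrix.vecCons x Y)‖₊ : ℝ≥0∞)) ≤ ENNReal.ofReal Mr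
    rw [coe_nnnorm_fkWitness]
    exact ENNReal.ofReal_le_ofReal (fkWitness_one_le_inv_sqrt v L T _)
  have h0Y : ∀ (Y : Config n) (x : Space), x ∉ box L → slice Ψ Y x = 0 := fun Y x hx =>
    slice_fkWitness_eq_zero v hT0 _ Y hx
  -- the two factors, at their own depths
  set rbar₁ : Config n → ℝ≥0∞ := fun Y => uvParticipation (slice Ψ Y) L K₁ with hrbar₁def
  set Prd₂ : Config n → ℝ := fun Y => coarsePR (slice Ψ Y) L K₂ with hPrd₂def
  have hrbar_meas : Measurable rbar₁ := measurable_uvParticipation hΨm L K₁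
  have hPrd_meas : Measurable Prd₂ := by
    show Measurable fun Y => ∏ j ∈ Finset.range K₂, (1 + siblingExcess (slice Ψ Y) L j)
    refine Finset.measurable_prod _ fun j _ => ?_
    exact (measurable_siblingExcess hΨm L j).const_add 1
  have hPrdnn : ∀ Y, 0 ≤ Prd₂ Y := fun Y => coarsePR_nonneg _ _ _
  set F₂ : Config n → ℝ≥0∞ := fun Y => ENNReal.ofReal ((8 : ℝ) ^ l₂ * Prd₂ Y) with hF₂def
  have hF₂_meas : Measurable F₂ := ENNReal.measurable_ofReal.comp (hPrd_meas.const_mul _)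
  -- pointwise: telescoping at depth `K`, then move each factor to its own depth
  have hpt : ∀ Y, ENNReal.ofReal (L ^ 3) * (∫⁻ x, slice Ψ Y x ^ 2) ^ 2 / (∫⁻ x, slice Ψ Y x) ^ 2 ≤
      m Y * (rbar₁ Y * F₂ Y) := by
    intro Y
    have h := landscape_le_telescope (measurable_slice hΨm Y) hLpos (h0Y Y)
      ENNReal.ofReal_ne_top (hbound Y) K
    have hr : uvParticipation (slice Ψ Y) L K ≤ rbar₁ Y := uvParticipation_anti _ hLpos.le hK₁K
    have hp : (∏ j ∈ Finset.range K, (1 + siblingExcess (slice Ψ Y) L j)) ≤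
        (8 : ℝ) ^ l₂ * Prd₂ Y := by
      have h' := coarsePR_le_pow_mul (slice Ψ Y) L hK₂K
      refine h'.trans (mul_le_mul_of_nonneg_right ?_ (hPrdnn Y))
      exact pow_le_pow_right₀ (by norm_num) hKK₂
    calc _ ≤ _ := h
      _ ≤ rbar₁ Y * F₂ Y * m Y :=
          mul_le_mul' (mul_le_mul' hr (ENNReal.ofReal_le_ofReal hp)) le_rfl
      _ = m Y * (rbar₁ Y * F₂ Y) := by ring
  -- Cauchy–Schwarz under the slice law
  have hCS : ∫⁻ Y, (rbar₁ * F₂) Y ∂μ ≤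
      (∫⁻ Y, rbar₁ Y ^ (2 : ℝ) ∂μ) ^ (1 / (2 : ℝ)) * (∫⁻ Y, F₂ Y ^ (2 : ℝ) ∂μ) ^ (1 / (2 : ℝ)) :=
    ENNReal.lintegral_mul_le_Lp_mul_Lq μ Real.HolderConjugate.two_two hrbar_meas.aemeasurable
      hF₂_meas.aemeasurable
  -- the UV factor (stub `KineticScaleFlatness` at its depth `K₁`)
  have hUVfac : ∫⁻ Y, rbar₁ Y ^ (2 : ℝ) ∂μ ≤ ENNReal.ofReal CU := by
    simp only [ENNReal.rpow_two]
    rw [hμdef, lintegral_withDensity_eq_lintegral_mul _ hm_meas (hrbar_meas.pow_const 2)]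
    exact h1 T hT
  -- the IR factor (stub `CoarseSecondMoment` at its depth `K₂`, times the free octaves)
  have hIRfac : ∫⁻ Y, F₂ Y ^ (2 : ℝ) ∂μ ≤ ENNReal.ofReal E := by
    simp only [ENNReal.rpow_two]
    have hsplit : ∀ Y, F₂ Y ^ 2 = ENNReal.ofReal ((64 : ℝ) ^ l₂) * ENNReal.ofReal (Prd₂ Y) ^ 2 := by
      intro Y
      show (ENNReal.ofReal ((8 : ℝ) ^ l₂ * Prd₂ Y)) ^ 2 = _
      rw [ENNReal.ofReal_mul (by positivity), mul_pow, ← ENNReal.ofReal_pow (by positivity),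
        ← pow_mul, show (8 : ℝ) ^ (l₂ * 2) = 64 ^ l₂ by rw [mul_comm, pow_mul]; norm_num]
    simp_rw [hsplit]
    rw [lintegral_const_mul' _ _ ENNReal.ofReal_ne_top, hμdef,
      lintegral_withDensity_eq_lintegral_mul _ hm_meas
        (show Measurable (fun Y => ENNReal.ofReal (Prd₂ Y) ^ 2) from
          (ENNReal.measurable_ofReal.comp hPrd_meas).pow_const 2),
      hEdef, ENNReal.ofReal_mul (by positivity)]
    gcongr
    exact h2 T hT
  -- assemble
  calc ∫⁻ Y, ENNReal.ofReal (L ^ 3) * (∫⁻ x, slice Ψ Y x ^ 2) ^ 2 / (∫⁻ x, slice Ψ Y x) ^ 2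
      ≤ ∫⁻ Y, m Y * (rbar₁ Y * F₂ Y) := lintegral_mono hpt
    _ = ∫⁻ Y, (rbar₁ * F₂) Y ∂μ := by
        rw [hμdef, lintegral_withDensity_eq_lintegral_mul _ hm_meas (hrbar_meas.mul hF₂_meas)]
        rfl
    _ ≤ (∫⁻ Y, rbar₁ Y ^ (2 : ℝ) ∂μ) ^ (1 / (2 : ℝ)) * (∫⁻ Y, F₂ Y ^ (2 : ℝ) ∂μ) ^ (1 / (2 : ℝ)) := hCS
    _ ≤ (ENNReal.ofReal CU) ^ (1 / (2 : ℝ)) * (ENNReal.ofReal E) ^ (1 / (2 : ℝ)) := by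
        gcongr
    _ = (ENNReal.ofReal (CU * E)) ^ (1 / (2 : ℝ)) := by
        rw [← ENNReal.mul_rpow_of_nonneg _ _ (by norm_num : (0:ℝ) ≤ 1 / 2),
          ← ENNReal.ofReal_mul hCU.le]
    _ ≤ ENNReal.ofReal (CU * E) + 1 := rpow_half_le_add_one _
    _ = ENNReal.ofReal (CU * E + 1) := by
        rw [ENNReal.ofReal_add (by positivity) zero_le_one, ENNReal.ofReal_one]

/-- The crux from the two open stubs (what the closing `Theorems/` file will say once both stubs are
theorems of the tree; displayed `closure.modulo` the two sorries). -/
theorem twoReplicaTransienceBound_proof_skeleton :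
    Summit.AtomisticToContinuum.BoseEinsteinCondensation.Theses.BECCutLineWeakDisorder.TwoReplicaTransienceBound :=
  TwoReplicaTransienceBound_of stub_kineticScaleFlatness stub_coarseSecondMoment

/-- The same composition over the plain statements (for importers that prove `KineticScaleFlatness` /
`CoarseSecondMoment` under their own names; the `Goal` aliases are reducible). -/
theorem twoReplica_of_kineticFrame (hUV : KineticScaleFlatness) (hIR : CoarseSecondMoment) :
    Summit.AtomisticToContinuum.BoseEinsteinCondensation.Theses.BECCutLineWeakDisorder.TwoReplicaTransienceBound :=
  TwoReplicaTransienceBound_of hUV hIR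

end Summit.AtomisticToContinuum.BoseEinsteinCondensation.Cruxes.TwoReplicaTransienceBound.KineticBlockBolthausen

end
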